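import Literature.Topology.FourManifolds.GroupTrisections
import HarnessLib

/-!
# Epimorphisms of the surface group `S_g` onto the free group `F_g` are unique up to `Aut(S_g)`
(Grigorchuk–Kurchanov 1990; Zieschang 1964; Leininger–Reid 2002, Lemma 2.2)

Topic `Literature/Topology/FourManifolds` (vocabulary of `GroupTrisections.lean`: the presented
surface group `SurfaceGroup g = ⟨a₁,b₁,…,a_g,b_g ∣ ∏[aᵢ,bᵢ]⟩`, `IsFreeOfRank`). Cite item `wi-25609`
(route SmoothPoincare4/CongruenceShadows, item `WaldhausenPairs`: the kernel form below).

* NAMED FACT `GrigorchukKurchanov1990_stronglyEquivalent` — any two epimorphisms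
  `α, β : S_g ↠ F_g` are STRONGLY EQUIVALENT: `α ∘ γ = β` for an automorphism `γ` of `S_g`.
* PROVED `GrigorchukKurchanov1990_stronglyEquivalent.exists_mulEquiv_map_eq` — **kernel form**:
  for normal `K, K' ⊴ S_g` with `S_g/K ≅ F_g ≅ S_g/K'` there is `α ∈ Aut(S_g)` with `α(K) = K'`.

## What is printed

Grigorchuk–Kurchanov 1990 (Mat. Zametki 48 (2), 26–35 = Math. Notes 48, 736–742), main theorem, as
reviewed in Zbl 0810.20032 (W. Heil; the translation doi:10.1007/bf01262604 is not held —
acquisition acq-04847): "For a minimal strictly quadratic word `S = S(x₁, …, xₙ)` the group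
`Γ_S = ⟨x₁, …, xₙ : S = 1⟩` is isomorphic to the fundamental group of a closed surface. Two
epimorphisms `α, β : Γ_S → F_r` of `Γ_S` to the free group of rank `r` are called strongly
equivalent if there is an automorphism `γ : Γ_S → Γ_S` such that `α ∘ γ = β`. It is known that
there does not exist any epimorphism `α` if `r > [n/2]`. The authors show that for `r ≤ [n/2]`
there exists a finite number `q` of strong equivalence classes of epimorphisms `Γ_S → F_r`. If
`Γ_S` corresponds to an orientable surface then `q = 1`. …" We vendor the orientable case
`S = ∏ᵢ [aᵢ, bᵢ]` (`n = 2g`) at the rank `r = g` the route consumes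
(`-- TODO(general form): every rank r ≤ g, and the non-orientable counts 2^r, 2^r − 1`).
Geometric content and proof route in print: every epimorphism `π₁(Σ_g) ↠ F_g` is induced by a
handlebody bounded by `Σ_g` — Leininger–Reid 2002, Lemma 2.2 (arXiv math/0202261, §2.2, read:
transversality to a wedge of circles, 2-handles along the preimage curves, Hopfian property of
`F_g`); Abrams–Gay–Kirby 2018, §2 ("a standard fact … See [LeiningerReid] for a proof"); with
any two genus-`g` handlebodies homeomorphic and every automorphism of `F_g = π₁(H_g)` induced by
a homeomorphism of the handlebody (Zieschang 1964, Nielsen's method), two epimorphisms differ by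
the automorphism of `π₁(Σ_g)` induced by the resulting surface homeomorphism.

## Why the kernel form follows (proved below)

Given normal `K, K'` with both quotients free of rank `g`, choose identifications
`S_g/K ≅ F_g ≅ S_g/K'` and let `α, β : S_g ↠ F_g` be the two projections (kernels `K`, `K'`).
Strong equivalence gives `γ ∈ Aut(S_g)` with `α ∘ γ = β`, so `K' = ker β = γ⁻¹(K)`, i.e.
`γ⁻¹(K) = K'`: take `γ⁻¹`.
-/

namespace Literature.Topology.FourManifolds

/-- **Grigorchuk–Kurchanov 1990 (orientable case, rank `g`): epimorphisms of the genus-`g`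
surface group onto the free group of rank `g` form a single strong equivalence class** (named
fact, not proved here). For every `g` and any two SURJECTIVE homomorphisms
`α, β : S_g →* F_g` (`SurfaceGroup g`, `FreeGroup (Fin g)`) there is an automorphism `γ` of `S_g`
with `α ∘ γ = β`. The case `S = ∏[aᵢ,bᵢ]`, `r = g = [n/2]`, `q = 1` of the printed theorem
(Zbl 0810.20032: "Two epimorphisms `α, β : Γ_S → F_r` … are called strongly equivalent if there is
an automorphism `γ : Γ_S → Γ_S` such that `α ∘ γ = β` … If `Γ_S` corresponds to an orientable
surface then `q = 1`"); geometric proof: Leininger–Reid 2002, Lemma 2.2 with Zieschang 1964.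
Users take `(h : GrigorchukKurchanov1990_stronglyEquivalent)`.
[cite: GrigorchukKurchanov1990, main theorem (orientable case, r = g), reviewed Zbl 0810.20032]
[cite: LeiningerReid2002, Lemma 2.2] [cite: Zieschang1964] -/
def GrigorchukKurchanov1990_stronglyEquivalent : Prop :=
  ∀ (g : ℕ) (α β : SurfaceGroup g →* FreeGroup (Fin g)),
    Function.Surjective α → Function.Surjective β →
      ∃ γ : SurfaceGroup g ≃* SurfaceGroup g, α.comp γ.toMonoidHom = β

-- TODO(general form): Grigorchuk–Kurchanov 1990 prove strong equivalence onto `F_r` for every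
-- `r ≤ g` (orientable case) and count the classes for non-orientable surface groups.

/-- The projection `S_g ↠ S_g/K ≅ F_g` attached to an identification of the quotient with the
free group: a surjection with kernel `K`. [folklore] -/
theorem exists_surjective_ker_eq {g : ℕ} (K : Subgroup (SurfaceGroup g)) [K.Normal]
    (hK : IsFreeOfRank (SurfaceGroup g ⧸ K) g) :
    ∃ α : SurfaceGroup g →* FreeGroup (Fin g), Function.Surjective α ∧ α.ker = K := by
  obtain ⟨e⟩ := hK
  refine ⟨e.symm.toMonoidHom.comp (QuotientGroup.mk' K), ?_, ?_⟩
  · exact e.symm.surjective.comp (QuotientGroup.mk'_surjective K)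
  · ext x
    rw [MonoidHom.mem_ker, MonoidHom.comp_apply, MulEquiv.coe_toMonoidHom,
      MulEquiv.map_eq_one_iff, QuotientGroup.mk'_apply, QuotientGroup.eq_one_iff]

/-- **Kernel form** (the statement item `WaldhausenPairs` of route CongruenceShadows consumes):
if `K, K' ⊴ S_g` are normal subgroups with `S_g/K` and `S_g/K'` both free of rank `g`, then some
automorphism of `S_g` carries `K` onto `K'` — PROVED from strong equivalence: with
`α : S_g ↠ S_g/K ≅ F_g` and `β : S_g ↠ S_g/K' ≅ F_g`, `α ∘ γ = β` gives `K' = γ⁻¹(K)`, so `γ⁻¹`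
works. [cite: GrigorchukKurchanov1990, main theorem (orientable case, r = g), reviewed Zbl 0810.20032] -/
theorem GrigorchukKurchanov1990_stronglyEquivalent.exists_mulEquiv_map_eq
    (h : GrigorchukKurchanov1990_stronglyEquivalent) {g : ℕ}
    (K K' : Subgroup (SurfaceGroup g)) [K.Normal] [K'.Normal]
    (hK : IsFreeOfRank (SurfaceGroup g ⧸ K) g) (hK' : IsFreeOfRank (SurfaceGroup g ⧸ K') g) :
    ∃ α : SurfaceGroup g ≃* SurfaceGroup g, K.map α.toMonoidHom = K' := by
  obtain ⟨α, hαs, hαk⟩ := exists_surjective_ker_eq K hK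
  obtain ⟨β, hβs, hβk⟩ := exists_surjective_ker_eq K' hK'
  obtain ⟨γ, hγ⟩ := h g α β hαs hβs
  refine ⟨γ.symm, ?_⟩
  -- `K.map γ⁻¹ = γ⁻¹(K)`-image `= {x | γ x ∈ K} = ker (α ∘ γ) = ker β = K'`
  have key : ∀ z : SurfaceGroup g, z ∈ K' ↔ γ z ∈ K := fun z ↦ by
    rw [← hβk, ← hαk, MonoidHom.mem_ker, MonoidHom.mem_ker, ← hγ]
    simp
  ext x
  rw [Subgroup.mem_map, key]
  constructor
  · rintro ⟨y, hy, rfl⟩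
    simpa using hy
  · intro hx
    exact ⟨γ x, hx, by simp⟩

end Literature.Topology.FourManifolds
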